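import Summits.Parity.GeneralizedHardyLittlewood.Theorems.BeyondDiagonalBeatsQuarter.KernelFormXSqLocalSum
import HarnessLib

/-!
# The local factors behind the `X²` kernel form, III: `Σ_m h_n(m) = ζ(2)·∏_{p∣n}(p+1)/(p−1)`

Supports stmt-Parity-20343 (`PrimeLevelFamEdge.BeyondDiagonalBeatsQuarter`, K_B; line
`diagonal_kernel_split`, registered stub `stub_kernelFormXSq`). A helper; it closes nothing. Namespace
`Summit.Parity.GeneralizedHardyLittlewood.Theorems.BeyondDiagonalBeatsQuarter.KernelFormXSq`.

The Euler product of the absolutely summable multiplicative function `h_n`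
(`KernelFormXSqLocal`, `KernelFormXSqLocalSum`): its local factor is `Σ_j h_n(p^j) = (1 − p⁻²)⁻¹`
for `p ∤ n` and `(1 − p⁻¹)⁻²` for `p ∣ n` (`hasSum_hloc_prime_pow`), so that
`Σ_m h_n(m) = ζ(2)·∏_{p∣n}(p+1)/(p−1)` (`hasSum_hloc`; `ζ(2) = π²/6` from Mathlib's
`hasSum_zeta_two` through the Euler product of `n ↦ n⁻²`). This is the value `E_n` with
`S(y;n) → 2E_n` in the kernel asymptotics; the KEY algebraic fact used downstream is
`φ(n)W(n)²·E_n = ζ(2)|W(n)|`. Everything here is PROVED (theorems only).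

## References
* E. Kowalski, P. Michel, J. VanderKam, J. reine angew. Math. 526 (2000), Prop. 5.1 p. 18 (the
  constant `ζ(2)²`-structure of the diagonal second moment). [cite: KowalskiMichelVanderKam2000, Prop. 5.1 — derivation]
«The programme SEARCHES and TYPES; no claim about Landau–Siegel zeros, Theorems 1–2 of
arXiv:2211.02515 or a repaired Margin232 until a kernel theorem says so.»
-/

noncomputable section

open scoped Real ArithmeticFunction.Moebius ArithmeticFunction.sigma ArithmeticFunction.zeta
open Finset ArithmeticFunction

namespace Summit.Parity.GeneralizedHardyLittlewood.Theorems.BeyondDiagonalBeatsQuarter.KernelFormXSq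

open Literature.NumberTheory.LFunctions Literature.NumberTheory.LFunctions.KMV2000
open MollifierMainTerm (W G invA sqInv)

/-- The local Euler factor of `h_n` at `p`: `Σ_j h_n(p^j) = (1 − p⁻¹)⁻²` if `p ∣ n`, `(1 − p⁻²)⁻¹`
if `p ∤ n`. [cite: KowalskiMichelVanderKam2000, Prop. 5.1 — derivation (local factors)] -/
theorem hasSum_hloc_prime_pow (n : ℕ) {p : ℕ} (hp : p.Prime) :
    HasSum (fun j : ℕ ↦ hloc n (p ^ j))
      (if p ∣ n then ((1 - (p : ℝ)⁻¹) ^ 2)⁻¹ else (1 - ((p : ℝ) ^ 2)⁻¹)⁻¹) := by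
  have hp1 : (1 : ℝ) < p := by exact_mod_cast hp.one_lt
  have hp0 : (0 : ℝ) < p := by linarith
  set x : ℝ := (p : ℝ)⁻¹ with hx
  have hx0 : 0 ≤ x := by positivity
  have hx1 : x < 1 := inv_lt_one_of_one_lt₀ hp1
  have hxn : ‖x‖ < 1 := by rw [Real.norm_eq_abs, abs_of_nonneg hx0]; exact hx1
  have hg := hasSum_geometric_of_lt_one hx0 hx1
  have hj := hasSum_coe_mul_geometric_of_norm_lt_one hxn
  have hpow : ∀ j : ℕ, ((p : ℝ) ^ j)⁻¹ = x ^ j := fun j ↦ by rw [hx, inv_pow]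
  have h1x : 1 - x ≠ 0 := by linarith
  by_cases hpn : p ∣ n
  · rw [if_pos hpn]
    have hsum := hj.add hg
    have hval : x / (1 - x) ^ 2 + (1 - x)⁻¹ = ((1 - x) ^ 2)⁻¹ := by
      field_simp
      ring
    rw [hval] at hsum
    refine hsum.congr_fun fun j ↦ ?_
    rw [hloc_apply_prime_pow hp, if_pos hpn, hpow]
    ring
  · rw [if_neg hpn]
    have hsum := hg.add (hj.mul_left ((1 - (p : ℝ)) / ((p : ℝ) + 1)))
    have hpp : (p : ℝ) + 1 ≠ 0 := by positivity
    have hpm : (p : ℝ) - 1 ≠ 0 := by linarith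
    have hp2 : (p : ℝ) ^ 2 - 1 ≠ 0 := by nlinarith
    have hp0' : (p : ℝ) ≠ 0 := hp0.ne'
    have e1 : (1 - x)⁻¹ = p / (p - 1) := by rw [hx]; field_simp
    have e2 : x / (1 - x) ^ 2 = p / (p - 1) ^ 2 := by rw [hx]; field_simp
    have e3 : (1 - ((p : ℝ) ^ 2)⁻¹)⁻¹ = (p : ℝ) ^ 2 / ((p : ℝ) ^ 2 - 1) := by field_simp
    have hval : (1 - x)⁻¹ + (1 - (p : ℝ)) / ((p : ℝ) + 1) * (x / (1 - x) ^ 2) =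
        (1 - ((p : ℝ) ^ 2)⁻¹)⁻¹ := by
      rw [e1, e2, e3, eq_div_iff hp2]
      field_simp
      ring
    rw [hval] at hsum
    refine hsum.congr_fun fun j ↦ ?_
    rw [hloc_apply_prime_pow hp, if_neg hpn]
    have : ((p : ℝ) + 1 + j - j * p) / (((p : ℝ) + 1) * (p : ℝ) ^ j) =
        ((p : ℝ) ^ j)⁻¹ + (1 - (p : ℝ)) / ((p : ℝ) + 1) * (j * ((p : ℝ) ^ j)⁻¹) := by
      field_simp
      ring
    rw [this, hpow]

/-- **`Σ_m h_n(m) = (π²/6)·∏_{p∣n} (p+1)/(p−1)`** for `n ≥ 1`: the Euler product of `h_n`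
(`(1 − p⁻²)⁻¹` off `n`, `(1−p⁻¹)⁻²` on `n`) against `∏_p (1 − p⁻²)⁻¹ = ζ(2)`.
[cite: KowalskiMichelVanderKam2000, Prop. 5.1 — derivation (the constant ζ(2)² of (31))] -/
theorem hasSum_hloc {n : ℕ} (hn : n ≠ 0) :
    HasSum (fun m ↦ hloc n m)
      (π ^ 2 / 6 * ∏ p ∈ n.primeFactors, (((p : ℝ) + 1) / ((p : ℝ) - 1))) := by
  -- the Euler product of `h_n`
  have hsum : Summable fun m ↦ ‖hloc n m‖ :=
    (summable_abs_hloc hn).congr fun m ↦ (Real.norm_eq_abs _).symm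
  have hE := (isMultiplicative_hloc n).eulerProduct_hasProd hsum
  have hloc_fac : ∀ p : Nat.Primes, ∑' e : ℕ, hloc n ((p : ℕ) ^ e) =
      (if (p : ℕ) ∣ n then ((1 - (p : ℝ)⁻¹) ^ 2)⁻¹ else (1 - ((p : ℝ) ^ 2)⁻¹)⁻¹) :=
    fun p ↦ (hasSum_hloc_prime_pow n p.2).tsum_eq
  have hE' : HasProd (fun p : Nat.Primes ↦
      (if (p : ℕ) ∣ n then ((1 - (p : ℝ)⁻¹) ^ 2)⁻¹ else (1 - ((p : ℝ) ^ 2)⁻¹)⁻¹))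
      (∑' m, hloc n m) :=
    hE.congr_fun fun p ↦ (hloc_fac p).symm
  -- the Euler product of `m ↦ m⁻²`: `∏ (1 − p⁻²)⁻¹ = π²/6`
  have hsq : Summable fun m ↦ ‖sqInv m‖ := by
    refine (Real.summable_nat_pow_inv.mpr one_lt_two).congr fun m ↦ ?_
    simp [sqInv]
  have hZ := EulerProduct.eulerProduct_completely_multiplicative_hasProd hsq
  have hZv : ∑' m : ℕ, sqInv m = π ^ 2 / 6 := by
    rw [← hasSum_zeta_two.tsum_eq]
    exact tsum_congr fun m ↦ by simp [sqInv, one_div]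
  rw [hZv] at hZ
  -- the finite correction at the primes dividing `n`
  set T : Finset Nat.Primes := (n.primeFactors.attach).image
    fun x ↦ (⟨x.1, Nat.prime_of_mem_primeFactors x.2⟩ : Nat.Primes) with hT
  have hmemT : ∀ p : Nat.Primes, p ∈ T ↔ (p : ℕ) ∈ n.primeFactors := by
    intro p
    rw [hT, Finset.mem_image]
    constructor
    · rintro ⟨x, -, rfl⟩; exact x.2
    · intro hp; exact ⟨⟨p, hp⟩, Finset.mem_attach _ _, Subtype.ext rfl⟩
  set r : Nat.Primes → ℝ := fun p ↦ if (p : ℕ) ∣ n then ((p : ℝ) + 1) / ((p : ℝ) - 1) else 1 with hr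
  have hr1 : ∀ p ∉ T, r p = 1 := by
    intro p hp
    rw [hmemT] at hp
    simp only [hr]
    rw [if_neg]
    intro hdvd
    exact hp (Nat.mem_primeFactors.2 ⟨p.2, hdvd, hn⟩)
  have hprodT : ∏ p ∈ T, r p = ∏ p ∈ n.primeFactors, (((p : ℝ) + 1) / ((p : ℝ) - 1)) := by
    rw [hT, Finset.prod_image]
    · rw [← Finset.prod_attach n.primeFactors]
      refine Finset.prod_congr rfl fun x _ ↦ ?_
      simp only [hr]
      rw [if_pos (Nat.dvd_of_mem_primeFactors x.2)]
    · intro x _ y _ hxy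
      exact Subtype.ext (by simpa using congr_arg Subtype.val hxy)
  have hR : HasProd r (∏ p ∈ n.primeFactors, (((p : ℝ) + 1) / ((p : ℝ) - 1))) := by
    rw [← hprodT]; exact hasProd_prod_of_ne_finset_one hr1
  -- local factor of `h_n` = (local factor of `m⁻²`) · r
  have hmul := hZ.mul hR
  have heq : (fun p : Nat.Primes ↦ (1 - sqInv p)⁻¹ * r p) = fun p : Nat.Primes ↦
      (if (p : ℕ) ∣ n then ((1 - (p : ℝ)⁻¹) ^ 2)⁻¹ else (1 - ((p : ℝ) ^ 2)⁻¹)⁻¹) := by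
    funext p
    have hp1 : (1 : ℝ) < (p : ℕ) := by exact_mod_cast p.2.one_lt
    have hpm : ((p : ℕ) : ℝ) - 1 ≠ 0 := by linarith
    have hpp : ((p : ℕ) : ℝ) + 1 ≠ 0 := by linarith
    have hp0 : ((p : ℕ) : ℝ) ≠ 0 := by linarith
    have hsq' : sqInv p = (((p : ℕ) : ℝ) ^ 2)⁻¹ := rfl
    simp only [hr, hsq']
    by_cases hpn : (p : ℕ) ∣ n
    · rw [if_pos hpn, if_pos hpn]
      have hp2 : ((p : ℕ) : ℝ) ^ 2 - 1 ≠ 0 := by nlinarith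
      have e3 : (1 - (((p : ℕ) : ℝ) ^ 2)⁻¹)⁻¹ = ((p : ℕ) : ℝ) ^ 2 / (((p : ℕ) : ℝ) ^ 2 - 1) := by
        field_simp
      have e4 : ((1 - ((p : ℕ) : ℝ)⁻¹) ^ 2)⁻¹ = ((p : ℕ) : ℝ) ^ 2 / (((p : ℕ) : ℝ) - 1) ^ 2 := by
        field_simp
      rw [e3, e4, div_mul_div_comm, div_eq_div_iff (mul_ne_zero hp2 hpm) (pow_ne_zero 2 hpm)]
      ring
    · rw [if_neg hpn, if_neg hpn, mul_one]
  rw [heq] at hmul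
  have huniq : ∑' m, hloc n m = π ^ 2 / 6 * ∏ p ∈ n.primeFactors, (((p : ℝ) + 1) / ((p : ℝ) - 1)) :=
    hE'.unique hmul
  rw [← huniq]
  exact (summable_hloc hn).hasSum

end Summit.Parity.GeneralizedHardyLittlewood.Theorems.BeyondDiagonalBeatsQuarter.KernelFormXSq
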